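import Mathlib.RingTheory.Ideal.Cotangent
import Mathlib.RingTheory.Localization.AtPrime.Basic
import Mathlib.RingTheory.Localization.Ideal
import HarnessLib

/-!
# `𝔪/𝔪² ≅ 𝔪S_𝔪/(𝔪S_𝔪)²`: the cotangent space at a maximal ideal is unchanged by localisation

Topic `Literature/RingTheory/Localization`, namespace `Literature.RingTheory.Localization`.  THEOREMS ONLY (one `abbrev` for the
comparison map); Mathlib-only; no named fact (net debt 0).

THE PRINT.  For a commutative ring `S`, a MAXIMAL ideal `𝔪 ⊆ S` with residue field `κ = S/𝔪`, and any localisation `S' = S_𝔪`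
of `S` at `𝔪` (Mathlib `IsLocalization.AtPrime S' 𝔪`, e.g. the stalk of an affine scheme at a closed point), the canonical
`S`-linear map `𝔪/𝔪² → 𝔪S'/(𝔪S')²` is an isomorphism onto the Zariski cotangent space of the local ring `S'`
(`IsLocalRing.CotangentSpace S'`): Görtz–Wedhorn, *Algebraic Geometry I*, 2nd ed., §6.3, (6.3.1)–Remark 6.4 («for a closed point
`x ∈ X = Spec A` with maximal ideal `𝔪` … `T_x X = (𝔪/𝔪²)^*` … since `𝔪_x/𝔪_x² = 𝔪/𝔪²`»); Atiyah–Macdonald, Prop. 3.9 /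
exactness of localisation applied to `0 → 𝔪² → 𝔪 → 𝔪/𝔪² → 0` together with `(𝔪/𝔪²)_𝔪 = 𝔪/𝔪²` (a `κ`-vector space).  The
elementary proof below avoids module localisation: every element `x/s ∈ 𝔪S'` is congruent mod `(𝔪S')²` to `xt` with `st ≡ 1 (𝔪)`
(surjectivity), and `x ∈ 𝔪`, `csx ∈ 𝔪²` with `cs ∉ 𝔪` force `x = t(cs)x − (tcs − 1)x ∈ 𝔪²` (injectivity).

USE (cell `hodgecm-mathlib`, row II-2β, plan `PREP-II2beta-Prop26Qbar.md` step F1b): the cotangent space of an abelian variety at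
its origin is defined in the tree on the STALK (`Motives.AbelianVariety.Cotangent A = CotangentSpace 𝒪_{A,e}`), while a
model over a ring delivers it on an affine CHART `Spec S ∋ e` through the augmentation ideal `𝔪 = ker(e^♯ : S → κ)`
(`RingTheory/Smooth/AugmentationIdealCotangentBaseChange`); this file is the chart-to-stalk comparison `𝔪/𝔪² = 𝔪_e/𝔪_e²`.

WHAT IS PROVED (`𝔪` maximal, `[IsLocalization.AtPrime S' 𝔪]`): `cotangentToLocalization 𝔪 S' : 𝔪.Cotangent →ₗ[S]
(maximalIdeal S').Cotangent` (Mathlib's `Ideal.mapCotangent` along `S → S'`), its value on classes, `maximalIdeal S' = 𝔪S'`,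
**`cotangentToLocalization_bijective`**, and the `S`-linear equivalence **`cotangentLocalizationEquiv`**.

## References
* [GortzWedhorn2020] U. Görtz, T. Wedhorn, *Algebraic Geometry I*, 2nd ed. (2020), §6.3 (6.3.1) and Remark 6.4.
* [StacksProject] The Stacks project, Tag 00TV (localisation is exact) and Tag 0B2E (cotangent space at a point).
-/

noncomputable section

namespace Literature.RingTheory.Localization

open IsLocalRing

universe u v

variable {S : Type u} [CommRing S] (𝔪 : Ideal S) [h𝔪 : 𝔪.IsMaximal] (S' : Type v) [CommRing S'] [Algebra S S']
  [IsLocalization.AtPrime S' 𝔪] [IsLocalRing S']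

/-- `S → S_𝔪` maps `𝔪` into the maximal ideal of `S_𝔪`. [cite: GortzWedhorn2020, §6.3 (6.3.1) and Remark 6.4] -/
theorem le_comap_maximalIdeal : 𝔪 ≤ (maximalIdeal S').comap (Algebra.ofId S S') := fun x hx =>
  (IsLocalization.AtPrime.to_map_mem_maximal_iff S' 𝔪 x).2 hx

/-- **The maximal ideal of `S_𝔪` is the extension `𝔪S_𝔪`** (for any localisation `S'` of `S` at the maximal — or prime —
ideal `𝔪`; Mathlib has the `Localization.AtPrime` case as `Localization.AtPrime.map_eq_maximalIdeal`).
[cite: GortzWedhorn2020, §6.3 (6.3.1) and Remark 6.4] -/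
theorem map_eq_maximalIdeal : 𝔪.map (algebraMap S S') = maximalIdeal S' := by
  rw [← IsLocalization.AtPrime.under_maximalIdeal S' 𝔪 (h := inferInstance)]
  exact IsLocalization.map_under 𝔪.primeCompl S' _

/-- The canonical `S`-linear map **`𝔪/𝔪² → 𝔪S_𝔪/(𝔪S_𝔪)²`** into the cotangent space of the local ring `S_𝔪`
(Mathlib's `Ideal.mapCotangent` along `S → S_𝔪`). [cite: GortzWedhorn2020, §6.3 (6.3.1) and Remark 6.4] -/
abbrev cotangentToLocalization : 𝔪.Cotangent →ₗ[S] (maximalIdeal S').Cotangent :=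
  𝔪.mapCotangent (maximalIdeal S') (Algebra.ofId S S') (le_comap_maximalIdeal 𝔪 S')

/-- Value on classes: the class of `x ∈ 𝔪` goes to the class of `x/1`. [cite: GortzWedhorn2020, §6.3 (6.3.1) and Remark 6.4] -/
theorem cotangentToLocalization_toCotangent (x : 𝔪) :
    cotangentToLocalization 𝔪 S' (𝔪.toCotangent x) =
      (maximalIdeal S').toCotangent ⟨algebraMap S S' x, le_comap_maximalIdeal 𝔪 S' x.2⟩ :=
  Ideal.mapCotangent_toCotangent _ _ _ _ x

/-- An inverse of `s ∉ 𝔪` modulo the maximal ideal `𝔪`: `t` with `t s − 1 ∈ 𝔪`. [folklore] -/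
private theorem exists_mul_sub_one_mem {s : S} (hs : s ∈ 𝔪.primeCompl) : ∃ t : S, t * s - 1 ∈ 𝔪 := by
  obtain ⟨t, i, hi, h⟩ := h𝔪.exists_inv hs
  refine ⟨t, ?_⟩
  have e : t * s - 1 = -i := by rw [← h]; ring
  rw [e]
  exact 𝔪.neg_mem hi

omit h𝔪 in
/-- `x(ts − 1) ∈ 𝔪²` for `x ∈ 𝔪` and `ts ≡ 1 (𝔪)`. [folklore] -/
private theorem mul_sub_one_mem_sq {x t s : S} (hx : x ∈ 𝔪) (hts : t * s - 1 ∈ 𝔪) : x * (t * s - 1) ∈ 𝔪 ^ 2 := by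
  rw [pow_two]
  exact Ideal.mul_mem_mul hx hts

/-- **Surjectivity of `𝔪/𝔪² → 𝔪S_𝔪/(𝔪S_𝔪)²`**: `x/s ≡ xt (mod (𝔪S_𝔪)²)` for `ts ≡ 1 (𝔪)`, because
`xt − x/s = (x(ts − 1))/s` with `x(ts − 1) ∈ 𝔪²`. [cite: GortzWedhorn2020, §6.3 (6.3.1) and Remark 6.4] -/
theorem cotangentToLocalization_surjective : Function.Surjective (cotangentToLocalization 𝔪 S') := by
  intro y
  obtain ⟨⟨y, hy⟩, rfl⟩ := (maximalIdeal S').toCotangent_surjective y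
  obtain ⟨⟨x, s⟩, hxs⟩ := IsLocalization.surj 𝔪.primeCompl y
  -- `x ∈ 𝔪`: `x/1 = y s ∈ 𝔪S'`
  have hx : x ∈ 𝔪 := by
    rw [← IsLocalization.AtPrime.to_map_mem_maximal_iff S' 𝔪 x, ← hxs]
    exact Ideal.mul_mem_right _ _ hy
  obtain ⟨t, hts⟩ := exists_mul_sub_one_mem 𝔪 s.2
  refine ⟨𝔪.toCotangent ⟨x * t, Ideal.mul_mem_right _ _ hx⟩, ?_⟩
  rw [cotangentToLocalization_toCotangent, Ideal.toCotangent_eq]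
  -- `x t / 1 − y ∈ (𝔪S')²`: multiply by the unit `s/1`
  have hunit : IsUnit (algebraMap S S' s) := IsLocalization.map_units S' s
  rw [← Ideal.mul_unit_mem_iff_mem _ hunit]
  have e : (algebraMap S S' (x * t) - y) * algebraMap S S' s = algebraMap S S' (x * (t * s - 1)) := by
    rw [sub_mul, hxs, ← map_mul]
    simp only [map_sub, map_mul, map_one]
    ring
  rw [e, ← map_eq_maximalIdeal 𝔪 S', ← Ideal.map_pow]
  exact Ideal.mem_map_of_mem _ (mul_sub_one_mem_sq 𝔪 hx hts)

/-- **Injectivity of `𝔪/𝔪² → 𝔪S_𝔪/(𝔪S_𝔪)²`**: if `x/1 ∈ (𝔪S_𝔪)² = 𝔪²S_𝔪` then `c s x ∈ 𝔪²` for some `c, s ∉ 𝔪`, and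
`x = t(cs)x − (tcs − 1)x ∈ 𝔪²` for `t` an inverse of `cs` modulo `𝔪`. [cite: GortzWedhorn2020, §6.3 (6.3.1) and Remark 6.4] -/
theorem cotangentToLocalization_injective : Function.Injective (cotangentToLocalization 𝔪 S') := by
  rw [injective_iff_map_eq_zero]
  intro z hz
  obtain ⟨⟨x, hx⟩, rfl⟩ := 𝔪.toCotangent_surjective z
  rw [cotangentToLocalization_toCotangent, Ideal.toCotangent_eq_zero] at hz
  rw [Ideal.toCotangent_eq_zero]
  change algebraMap S S' x ∈ maximalIdeal S' ^ 2 at hz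
  rw [← map_eq_maximalIdeal 𝔪 S', ← Ideal.map_pow, IsLocalization.mem_map_algebraMap_iff 𝔪.primeCompl] at hz
  obtain ⟨⟨⟨a, ha⟩, s⟩, h⟩ := hz
  -- `x s / 1 = a / 1` with `a ∈ 𝔪²`, hence `c x s = c a` for some `c ∉ 𝔪`
  have h' : algebraMap S S' (x * s) = algebraMap S S' a := by rw [map_mul]; exact h
  obtain ⟨c, hc⟩ := (IsLocalization.eq_iff_exists 𝔪.primeCompl S').1 h'
  have hcs : (c : S) * s ∈ 𝔪.primeCompl := 𝔪.primeCompl.mul_mem c.2 s.2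
  obtain ⟨t, ht⟩ := exists_mul_sub_one_mem 𝔪 hcs
  have hmem : (c : S) * (x * s) ∈ 𝔪 ^ 2 := by rw [hc]; exact Ideal.mul_mem_left _ _ ha
  have e : x = t * ((c : S) * (x * s)) - x * (t * ((c : S) * s) - 1) := by ring
  change x ∈ 𝔪 ^ 2
  rw [e]
  exact Ideal.sub_mem _ (Ideal.mul_mem_left _ _ hmem) (mul_sub_one_mem_sq 𝔪 hx ht)

/-- **`𝔪/𝔪² ≅ 𝔪S_𝔪/(𝔪S_𝔪)²`** is bijective. [cite: GortzWedhorn2020, §6.3 (6.3.1) and Remark 6.4] -/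
theorem cotangentToLocalization_bijective : Function.Bijective (cotangentToLocalization 𝔪 S') :=
  ⟨cotangentToLocalization_injective 𝔪 S', cotangentToLocalization_surjective 𝔪 S'⟩

/-- **The cotangent space at a maximal ideal is unchanged by localisation**: the `S`-linear isomorphism
`𝔪/𝔪² ≃ 𝔪S_𝔪/(𝔪S_𝔪)² = CotangentSpace S_𝔪` («`𝔪_x/𝔪_x² = 𝔪/𝔪²`»). [cite: GortzWedhorn2020, §6.3 (6.3.1) and Remark 6.4]
[cite: StacksProject, Tag 00TV] -/
def cotangentLocalizationEquiv : 𝔪.Cotangent ≃ₗ[S] (maximalIdeal S').Cotangent :=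
  LinearEquiv.ofBijective _ (cotangentToLocalization_bijective 𝔪 S')

/-- Value of the equivalence on classes. [cite: GortzWedhorn2020, §6.3 (6.3.1) and Remark 6.4] -/
theorem cotangentLocalizationEquiv_toCotangent (x : 𝔪) :
    cotangentLocalizationEquiv 𝔪 S' (𝔪.toCotangent x) =
      (maximalIdeal S').toCotangent ⟨algebraMap S S' x, le_comap_maximalIdeal 𝔪 S' x.2⟩ :=
  cotangentToLocalization_toCotangent 𝔪 S' x

end Literature.RingTheory.Localization

end
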